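import Summits.BirchSwinnertonDyer.BirchSwinnertonDyer.Theorems.EisensteinPrimesMazurMCOnX1RankZeroInterludeResidualGL1Finiteness
import Summits.BirchSwinnertonDyer.BirchSwinnertonDyer.Theorems.EisensteinPrimesMazurMCOnX1RankZeroInterludeResidualGL1Continuity
import Summits.BirchSwinnertonDyer.BirchSwinnertonDyer.Theorems.TwoAdicConverseOrdLambdaHalfAtTwoGreenbergTameQuotientFinite
import HarnessLib

/-!
# Crux `MazurMCOnX1RankZero` (item stmt-BirchSwinnertonDyer-19035), line `interlude_with_torsion`, road B (B3):
# the TAME input is a theorem; (B3) from the two `μ = 0` inputs [Unr] ∧ [Even] (helper 4b)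

Cell `bsd-eis`, LEAD `cruxlead-19035` (g0), stub worker on `stub_residualGL1FinitenessOdd` (skeleton v8); `--supports`
stmt-BirchSwinnertonDyer-19035 as a HELPER.  `…InterludeResidualGL1Finiteness` (p689081) reduced (B3) to [Unr] ∧ [Tame] ∧ [Even].
This file PROVES [Tame] for EVERY discrete module of prime order over the cyclotomic tower — no continuity assumed — and
restates the reduction with two inputs:

* (from `…InterludeResidualGL1Continuity`) the junk case `H¹_cont(G, M) = 0` for a non-continuous action on a module of prime
  order (`discreteH1_eq_zero_of_not_continuous`) and the lift of continuity from `Gal(K̄/K_∞)` to `Γ_K`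
  (`continuous_smul_of_continuous_smul_kerSubgroup`).
* §3 [Tame] for CONTINUOUS actions (`finite_quotient_iInf_unramifiedKer_of_continuous`) — the cell `bsd-2adic` theorem
  `TwoAdicGreenbergCotorsion.finite_quotient_iInf_unramifiedKer_of_not_decomp_le` (p663165, trivial action) with «trivial»
  weakened to «continuous», as first written out by the ideator bsd-idea-11 g16 (Cruxes workfile
  `MazurMCOnX1RankZero/Lines/interlude_roadB_GL1Reduction_treeready_idea11g16.lean` §TameContinuous; adapted from there).
* §4 **`finite_quotient_iInf_unramifiedKer_cyclotomic`** — [Tame] for ALL modules of prime order, `κ` cyclotomic.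
* §5 **`residualGL1FinitenessOdd_of_unr_even`** (body verbatim) and **`…_of_unr_even'`** (BY NAME,
  `InterludeWithTorsion.ResidualGL1FinitenessOdd`): (B3) ⟸ [Unr] (Ferrero–Washington for the abelian field `K·ℚ(η)`, character
  form) ∧ [Even] (Greenberg, LNM 1716, Lemma 5.9 for the even one of `η, ηε_K`, via the swap `cycSwapH1`).
* §6 laws of the outer action `outerConjH1` (`_one`, `_mul`, `_absGaloisRestrict` = `conjH1`, involutivity for `τ² = 1`),
  the algebra behind the `±`-decomposition under `Gal(K_∞/ℚ_∞)` that a discharge of [Even] uses.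

HONEST FRAMING.  [Unr] and [Even] remain displayed hypotheses (class field theory / Ferrero–Washington / Greenberg's Lemma 5.9
are not in the tree); (B3) is REDUCED, not proved; BSD, Mazur's main conjecture and IMC2 are not proved by any of this.

References: R. Greenberg, LNM 1716 (1999), §3 Lemma 3.3, §5 Lemma 5.9, Prop. 5.10 [GreenbergLNM1716]; R. Greenberg, V. Vatsal,
Invent. Math. 142 (2000) §2 Prop. (2.4) [GreenbergVatsal2000]; L. Washington, *Introduction to Cyclotomic Fields* §13.1
[Washington1997]; J. W. S. Cassels, A. Fröhlich, *Algebraic Number Theory* Ch. I §8 [CasselsFrohlich1967].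
-/

set_option linter.dupNamespace false
set_option autoImplicit false

noncomputable section

open scoped Classical Pointwise

namespace Summit.BirchSwinnertonDyer.BirchSwinnertonDyer.Theorems.InterludeWithTorsion

open NumberField IsDedekindDomain Field
open Literature.NumberTheory.EllipticCurves Literature.NumberTheory.EllipticCurves.GreenbergSelmer
  Literature.NumberTheory.EllipticCurves.GreenbergVatsal2000 Literature.NumberTheory.GaloisRepresentations

/-! ## §3 [Tame] for CONTINUOUS actions (the cell `bsd-2adic` theorem p663165 with «trivial» weakened to «continuous»;
this weakening was first written out by the ideator bsd-idea-11 g16, §TameContinuous of the Cruxes workfile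
`MazurMCOnX1RankZero/Lines/interlude_roadB_GL1Reduction_treeready_idea11g16.lean` — adapted from there) -/

section TameContinuous

open WeierstrassCurve Summit.BirchSwinnertonDyer.Rank1Residual.Iwasawa
  Summit.BirchSwinnertonDyer.BirchSwinnertonDyer.Theorems.UniversalToricDescentResidualSelmerFinite
  Summit.BirchSwinnertonDyer.BirchSwinnertonDyer.Theorems.SelmerAcQuotientCorankLeGeneric
  Summit.BirchSwinnertonDyer.BirchSwinnertonDyer.Theorems.TwoAdicGreenbergCotorsion

variable {K : Type} [Field K] [NumberField K] {p : ℕ} [Fact p.Prime] (κ : ZpExtension K p)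
  (M : Type) [AddCommGroup M] [DistribMulAction (absoluteGaloisGroup K) M] [TopologicalSpace M] [DiscreteTopology M]

-- adapted from `TwoAdicGreenbergCotorsion.finite_subgroupH1_inf_decomp_of_trivial` (p663165) and idea-11 g16 §TameContinuous
/-- **`H¹(Gal(K̄/K_∞) ⊓ D_v, M)` is finite** for a finite discrete `Γ_K`-module `M` of `p`-power order with CONTINUOUS action, at
a place `v ∤ p` whose decomposition group is not inside `ker κ`: the local group `Gal(K̄_v/K_{∞,η})` surjects onto `ker κ ⊓ D_v`,
its `H¹` is finite by the tree's prime-to-`p` tower theorem `Iwasawa.NonsplitTower.finite_subgroupH1_and_natCard_le`, and inflation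
along a surjection is injective. [cite: GreenbergLNM1716, §3 Lemma 3.3 (proof, p. 87)] [cite: GreenbergVatsal2000, §2 Prop. (2.4)] -/
theorem finite_subgroupH1_inf_decomp_of_continuous [Finite M] (hM : ∃ k : ℕ, Nat.card M = p ^ k)
    (hcontK : ∀ m : M, Continuous fun σ : absoluteGaloisGroup K ↦ σ • m)
    {v : HeightOneSpectrum (𝓞 K)} (hpv : (p : 𝓞 K) ∉ v.asIdeal) (hv : ¬ (decomp v ≤ κ.kerSubgroup)) :
    Finite (subgroupH1 (κ.kerSubgroup ⊓ decomp v) M) := by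
  have hp : p.Prime := Fact.out
  letI : DistribMulAction (absoluteGaloisGroup (v.adicCompletion K)) M :=
    DistribMulAction.compHom _ (absGaloisRestrict K (v.adicCompletion K)).toMonoidHom
  have hcont : ∀ b : M, Continuous fun σ : absoluteGaloisGroup (v.adicCompletion K) ↦ σ • b := fun b ↦ by
    have : (fun σ : absoluteGaloisGroup (v.adicCompletion K) ↦ σ • b) =
        (fun σ : absoluteGaloisGroup K ↦ σ • b) ∘ (absGaloisRestrict K (v.adicCompletion K)) := rfl
    rw [this]
    exact (hcontK b).comp (absGaloisRestrict K (v.adicCompletion K)).continuous_toFun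
  have hns : ∃ σ : absoluteGaloisGroup (v.adicCompletion K),
      σ ∉ localSubgroup κ.kerSubgroup (v.adicCompletion K) := by
    by_contra hall
    refine hv fun g hg ↦ ?_
    obtain ⟨σ, rfl⟩ := (mem_decomp_iff v g).mp hg
    have hσ : σ ∈ localSubgroup κ.kerSubgroup (v.adicCompletion K) :=
      not_not.mp fun h ↦ hall ⟨σ, h⟩
    have h := (mem_localSubgroup_iff κ.kerSubgroup (v.adicCompletion K) σ).mp hσ
    rwa [resGal_eq_absGaloisRestrict] at h
  obtain ⟨k, hk⟩ := hM
  have hℓ := ringChar_residueField_prime (F := v.adicCompletion K)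
  have hne := v.ringChar_residueField_adicCompletion_ne hpv
  have hB : ∃ k : ℕ, ∀ b : M, p ^ k • b = 0 := ⟨k, fun b ↦ by rw [← hk]; exact card_nsmul_eq_zero'⟩
  have hfin := (NonsplitTower.finite_subgroupH1_and_natCard_le κ hpv hns hB (by
    rw [hk]
    exact ((Nat.coprime_primes hp hℓ).2 (Ne.symm hne)).pow_left k) hcont).1
  let θ : localSubgroup κ.kerSubgroup (v.adicCompletion K) →ₜ* (κ.kerSubgroup ⊓ decomp v :
      Subgroup (absoluteGaloisGroup K)) :=
    { toFun := fun x ↦ ⟨absGaloisRestrict K (v.adicCompletion K) x, Subgroup.mem_inf.mpr ⟨by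
          have h := (mem_localSubgroup_iff κ.kerSubgroup (v.adicCompletion K) x.1).mp x.2
          rwa [resGal_eq_absGaloisRestrict] at h, (mem_decomp_iff v _).mpr ⟨x, rfl⟩⟩⟩
      map_one' := Subtype.ext (by simp)
      map_mul' := fun x y ↦ Subtype.ext (by simp)
      continuous_toFun :=
        ((absGaloisRestrict K (v.adicCompletion K)).continuous_toFun.comp
          continuous_subtype_val).subtype_mk _ }
  have hθ : Function.Surjective θ := by
    rintro ⟨g, hg⟩
    obtain ⟨hgH, hgD⟩ := Subgroup.mem_inf.mp hg
    obtain ⟨σ, rfl⟩ := (mem_decomp_iff v g).mp hgD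
    have hσ : σ ∈ localSubgroup κ.kerSubgroup (v.adicCompletion K) := by
      rw [mem_localSubgroup_iff, resGal_eq_absGaloisRestrict]; exact hgH
    exact ⟨⟨σ, hσ⟩, rfl⟩
  exact Finite.of_injective _ (resH1Hom_injective_of_surjective θ hθ fun _ _ ↦ rfl)

-- adapted from `TwoAdicGreenbergCotorsion.finite_quotient_iInf_unramifiedKer_of_not_decomp_le` (p663165) and idea-11 g16
/-- **[Tame] for CONTINUOUS actions**: for a `ℤ_p`-extension `κ`, a place `v ∤ p` with `D_v ⊄ ker κ`, and a finite discrete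
`Γ_K`-module `M` of `p`-power order with continuous action, `H¹(ker κ, M) ⧸ ⨅_σ conj_σ⁻¹(unramifiedKer (ker κ) M v)` is FINITE
(signature map to `(H¹(ker κ ⊓ D_v, M))^{p^c}`; its kernel is locally trivial at every place above `v`, hence unramified there).
[cite: GreenbergVatsal2000, §2 Prop. (2.4)] [cite: CasselsFrohlich1967, Ch. I §8 Thm. 1, Cor. 3] -/
theorem finite_quotient_iInf_unramifiedKer_of_continuous [Finite M] (hM : ∃ k : ℕ, Nat.card M = p ^ k)
    (hcontK : ∀ m : M, Continuous fun σ : absoluteGaloisGroup K ↦ σ • m)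
    {v : HeightOneSpectrum (𝓞 K)} (hpv : (p : 𝓞 K) ∉ v.asIdeal) (hv : ¬ (decomp v ≤ κ.kerSubgroup)) :
    Finite (subgroupH1 κ.kerSubgroup M ⧸
      ⨅ σ : absoluteGaloisGroup K, (GreenbergVatsal2000.unramifiedKer κ.kerSubgroup M v).comap (conjH1 κ.kerSubgroup M σ)) := by
  haveI := finite_subgroupH1_inf_decomp_of_continuous κ M hM hcontK hpv hv
  set U : AddSubgroup (subgroupH1 κ.kerSubgroup M) :=
    ⨅ σ : absoluteGaloisGroup K, (GreenbergVatsal2000.unramifiedKer κ.kerSubgroup M v).comap (conjH1 κ.kerSubgroup M σ)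
  obtain ⟨c, hc⟩ := forall_resOfLe_conjH1_eq_zero_of_reps (κ := κ) (M := M) v hv
  have hτ' : ∀ i : ℕ, ∃ τ : absoluteGaloisGroup K, κ τ = Multiplicative.ofAdd ((i : ℕ) : ℤ_[p]) :=
    fun i ↦ κ.surjective _
  choose τ hτ using hτ'
  let res := resOfLe M (inf_le_left : κ.kerSubgroup ⊓ decomp v ≤ κ.kerSubgroup)
  let Ψ : subgroupH1 κ.kerSubgroup M →+ (Fin (p ^ c) → subgroupH1 (κ.kerSubgroup ⊓ decomp v) M) :=
    AddMonoidHom.pi fun i ↦ res.comp (conjH1 κ.kerSubgroup M (τ i))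
  have hker : Ψ.ker ≤ U := by
    intro y hy
    rw [AddMonoidHom.mem_ker] at hy
    have hy' : ∀ i, i < p ^ c → res (conjH1 κ.kerSubgroup M (τ i) y) = 0 := fun i hi ↦ congrFun hy ⟨i, hi⟩
    have hall := hc τ hτ y hy'
    simp only [U, AddSubgroup.mem_iInf, AddSubgroup.mem_comap]
    intro σ
    exact awayKer_le_unramifiedKer κ.kerSubgroup M v ((AddMonoidHom.mem_ker).mpr (hall σ))
  haveI : Finite (subgroupH1 κ.kerSubgroup M ⧸ Ψ.ker) :=
    Finite.of_injective (QuotientAddGroup.kerLift Ψ) (QuotientAddGroup.kerLift_injective Ψ)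
  haveI : Ψ.ker.FiniteIndex := AddSubgroup.finiteIndex_of_finite_quotient
  haveI : U.FiniteIndex := AddSubgroup.finiteIndex_of_le hker
  exact AddSubgroup.finite_quotient_of_finiteIndex

end TameContinuous

/-! ## §4 [Tame] for ALL modules of prime order over the cyclotomic tower (continuous ∨ junk) -/

section Tame

open Summit.BirchSwinnertonDyer.BirchSwinnertonDyer.Theorems.TwoAdicGreenbergCotorsion

variable {K : Type} [Field K] [NumberField K] {p : ℕ} [Fact p.Prime] (κ : ZpExtension K p)
  (M : Type) [AddCommGroup M] [DistribMulAction (absoluteGaloisGroup K) M] [TopologicalSpace M] [DiscreteTopology M]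

/-- **[Tame] is a THEOREM**: for the CYCLOTOMIC `ℤ_p`-extension `κ` of a number field `K`, a finite place `v ∤ p` and ANY discrete
`Γ_K`-module `M` of prime order `p` (no continuity assumed), `H¹(ker κ, M)` modulo the classes unramified at every place above `v`
is finite.  Continuous action: §3 (`v` is finitely decomposed in the cyclotomic tower, `not_decomp_le_kerSubgroup_of_isCyclotomic`);
non-continuous action: `Gal(K̄/K_∞)` acts non-continuously too (`continuous_smul_of_continuous_smul_kerSubgroup`), so
`H¹(ker κ, M) = 0` (`discreteH1_eq_zero_of_not_continuous`). [cite: GreenbergVatsal2000, §2 Prop. (2.4)]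
[cite: Washington1997, §13.1 (no finite place splits completely in the cyclotomic tower)] -/
theorem finite_quotient_iInf_unramifiedKer_cyclotomic (hκ : κ.IsCyclotomic) (hcard : Nat.card M = p)
    (v : HeightOneSpectrum (𝓞 K)) (hpv : ((p : ℕ) : 𝓞 K) ∉ v.asIdeal) :
    Finite (subgroupH1 κ.kerSubgroup M ⧸
      ⨅ σ : absoluteGaloisGroup K, (GreenbergVatsal2000.unramifiedKer κ.kerSubgroup M v).comap (conjH1 κ.kerSubgroup M σ)) := by
  have hp : p.Prime := Fact.out
  haveI : Finite M := Nat.finite_of_card_ne_zero (by rw [hcard]; exact hp.ne_zero)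
  by_cases hcont : ∀ m : M, Continuous fun g : κ.kerSubgroup ↦ g • m
  · exact finite_quotient_iInf_unramifiedKer_of_continuous κ M ⟨1, by rw [hcard, pow_one]⟩
      (continuous_smul_of_continuous_smul_kerSubgroup κ hcont) hpv (not_decomp_le_kerSubgroup_of_isCyclotomic κ hκ v)
  · haveI : Subsingleton (subgroupH1 κ.kerSubgroup M) := by
      refine ⟨fun a b ↦ ?_⟩
      rw [discreteH1_eq_zero_of_not_continuous (G := κ.kerSubgroup) (by rw [hcard]; exact hp) hcont a,
        discreteH1_eq_zero_of_not_continuous (G := κ.kerSubgroup) (by rw [hcard]; exact hp) hcont b]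
    infer_instance

end Tame


/-! ## §5 (B3) from the two `μ = 0` inputs -/

section Assembly

open Literature.NumberTheory.EllipticCurves.Castella2018

/-- **(B3) ⟸ [Unr] ∧ [Even]** — the registered stub's statement (body verbatim) from the two displayed `μ = 0` inputs of
`residualGL1FinitenessOdd_of_unr_tame_even` (`…InterludeResidualGL1Finiteness`), its tame input being the theorem
`finite_quotient_iInf_unramifiedKer_cyclotomic`:
* `hUnr` [FW]: everywhere-unramified classes of `H¹(K_∞, M)` finite (Ferrero–Washington for the abelian `K·ℚ(η)`);
* `hEven` [Greenberg's Lemma 5.9]: for some `τ ∈ Γ_ℚ ∖ res(Γ_K)`, `(1 + T_τ)` or `(1 − T_τ)` has finite image on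
  `H¹(K_p/K_∞, M)`, `T_τ = cycSwapH1 κ hκ M hM τ`.
[cite: GreenbergLNM1716, §5, Lemma 5.9 and proof of Prop. 5.10] [cite: FerreroWashington1979, Theorem]
[cite: GreenbergVatsal2000, §2 Prop. (2.4)] -/
theorem residualGL1FinitenessOdd_of_unr_even
    (hUnr : ∀ (K : Type) [Field K] [NumberField K], IsImaginaryQuadratic K →
      ∀ (p : ℕ) [Fact p.Prime], p ≠ 2 →
      ∀ (κ : ZpExtension K p), κ.IsCyclotomic →
      ∀ (M : Type) [AddCommGroup M] [DistribMulAction (absoluteGaloisGroup ℚ) M]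
        [DistribMulAction (absoluteGaloisGroup K) M] [TopologicalSpace M] [DiscreteTopology M],
        Nat.card M = p →
        (∀ (σ : absoluteGaloisGroup K) (m : M), σ • m = (absGaloisRestrict ℚ K σ) • m) →
        {c : subgroupH1 κ.kerSubgroup M | ∀ (v : HeightOneSpectrum (𝓞 K)) (σ : absoluteGaloisGroup K),
          conjH1 κ.kerSubgroup M σ c ∈ GreenbergVatsal2000.unramifiedKer κ.kerSubgroup M v}.Finite)
    (hEven : ∀ (K : Type) [Field K] [NumberField K] [IsGalois ℚ K], IsImaginaryQuadratic K →
      ∀ (p : ℕ) [Fact p.Prime], p ≠ 2 →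
      ∀ (κ : ZpExtension K p) (hκ : κ.IsCyclotomic),
      ∀ (M : Type) [AddCommGroup M] [DistribMulAction (absoluteGaloisGroup ℚ) M]
        [DistribMulAction (absoluteGaloisGroup K) M] [TopologicalSpace M] [DiscreteTopology M],
        Nat.card M = p →
        ∀ (hM : ∀ (σ : absoluteGaloisGroup K) (m : M), σ • m = (absGaloisRestrict ℚ K σ) • m),
        ∃ τ : absoluteGaloisGroup ℚ, τ ∉ Set.range (absGaloisRestrict ℚ K) ∧
          (((fun c ↦ c + cycSwapH1 κ hκ M hM τ c) ''
              (unramifiedOutside κ.kerSubgroup M p ∅ : Set (subgroupH1 κ.kerSubgroup M))).Finite ∨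
            ((fun c ↦ c - cycSwapH1 κ hκ M hM τ c) ''
              (unramifiedOutside κ.kerSubgroup M p ∅ : Set (subgroupH1 κ.kerSubgroup M))).Finite)) :
    ∀ (K : Type) [Field K] [NumberField K], IsImaginaryQuadratic K →
      ∀ (p : ℕ) [Fact p.Prime], p ≠ 2 →
      ∀ (κ : ZpExtension K p), κ.IsCyclotomic →
      ∀ (v vbar : HeightOneSpectrum (𝓞 K)), ((p : ℕ) : 𝓞 K) ∈ v.asIdeal → ((p : ℕ) : 𝓞 K) ∈ vbar.asIdeal →
        vbar ≠ v →
      ∀ (S : Set (HeightOneSpectrum (𝓞 K))), S.Finite →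
      ∀ (M : Type) [AddCommGroup M] [DistribMulAction (absoluteGaloisGroup ℚ) M]
        [DistribMulAction (absoluteGaloisGroup K) M] [TopologicalSpace M] [DiscreteTopology M],
        Nat.card M = p →
        (∀ (σ : absoluteGaloisGroup K) (m : M), σ • m = (absGaloisRestrict ℚ K σ) • m) →
        (GreenbergVatsal2000.datumStrictSelmer κ.kerSubgroup M p (AcSelmer.bdpData M p vbar) S :
          Set (subgroupH1 κ.kerSubgroup M)).Finite :=
  residualGL1FinitenessOdd_of_unr_tame_even hUnr
    (fun _ _ _ _ _ _ _ κ hκ M _ _ _ _ _ hcard _ v hpv ↦ finite_quotient_iInf_unramifiedKer_cyclotomic κ M hκ hcard v hpv)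
    hEven

/-- **(B3) BY NAME ⟸ [Unr] ∧ [Even]**: `InterludeWithTorsion.ResidualGL1FinitenessOdd` (`…InterludeDefs`, = the registered stub
`stub_residualGL1FinitenessOdd`) from the two displayed `μ = 0` inputs.  (B3) is REDUCED, not proved.
[cite: GreenbergLNM1716, §5, Lemma 5.9 and proof of Prop. 5.10] [cite: FerreroWashington1979, Theorem] -/
theorem residualGL1FinitenessOdd_of_unr_even'
    (hUnr : ∀ (K : Type) [Field K] [NumberField K], IsImaginaryQuadratic K →
      ∀ (p : ℕ) [Fact p.Prime], p ≠ 2 →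
      ∀ (κ : ZpExtension K p), κ.IsCyclotomic →
      ∀ (M : Type) [AddCommGroup M] [DistribMulAction (absoluteGaloisGroup ℚ) M]
        [DistribMulAction (absoluteGaloisGroup K) M] [TopologicalSpace M] [DiscreteTopology M],
        Nat.card M = p →
        (∀ (σ : absoluteGaloisGroup K) (m : M), σ • m = (absGaloisRestrict ℚ K σ) • m) →
        {c : subgroupH1 κ.kerSubgroup M | ∀ (v : HeightOneSpectrum (𝓞 K)) (σ : absoluteGaloisGroup K),
          conjH1 κ.kerSubgroup M σ c ∈ GreenbergVatsal2000.unramifiedKer κ.kerSubgroup M v}.Finite)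
    (hEven : ∀ (K : Type) [Field K] [NumberField K] [IsGalois ℚ K], IsImaginaryQuadratic K →
      ∀ (p : ℕ) [Fact p.Prime], p ≠ 2 →
      ∀ (κ : ZpExtension K p) (hκ : κ.IsCyclotomic),
      ∀ (M : Type) [AddCommGroup M] [DistribMulAction (absoluteGaloisGroup ℚ) M]
        [DistribMulAction (absoluteGaloisGroup K) M] [TopologicalSpace M] [DiscreteTopology M],
        Nat.card M = p →
        ∀ (hM : ∀ (σ : absoluteGaloisGroup K) (m : M), σ • m = (absGaloisRestrict ℚ K σ) • m),
        ∃ τ : absoluteGaloisGroup ℚ, τ ∉ Set.range (absGaloisRestrict ℚ K) ∧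
          (((fun c ↦ c + cycSwapH1 κ hκ M hM τ c) ''
              (unramifiedOutside κ.kerSubgroup M p ∅ : Set (subgroupH1 κ.kerSubgroup M))).Finite ∨
            ((fun c ↦ c - cycSwapH1 κ hκ M hM τ c) ''
              (unramifiedOutside κ.kerSubgroup M p ∅ : Set (subgroupH1 κ.kerSubgroup M))).Finite)) :
    InterludeWithTorsion.ResidualGL1FinitenessOdd :=
  residualGL1FinitenessOdd_of_unr_even hUnr hEven

end Assembly


/-! ## §6 Laws of the outer action (for the discharge of [Even]: `T_c` is an involution for a complex conjugation `c`) -/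

section Laws

variable {F L : Type} [Field F] [Field L] [NumberField L] [Algebra F L] [IsGalois F L]
variable (H : Subgroup (absoluteGaloisGroup L))
  (hH : ∀ (τ : absoluteGaloisGroup F) (x : absoluteGaloisGroup L), x ∈ H → absGaloisOuterConj F L τ x ∈ H)
variable (M : Type) [AddCommGroup M] [DistribMulAction (absoluteGaloisGroup F) M]
  [DistribMulAction (absoluteGaloisGroup L) M] [TopologicalSpace M] [DiscreteTopology M]
  (hM : ∀ (σ : absoluteGaloisGroup L) (m : M), σ • m = absGaloisRestrict F L σ • m)

/-- `outerConjH1 1 = id`. [cite: SerreGaloisCohomology1997, I §2.4] -/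
theorem outerConjH1_one : outerConjH1 H hH M hM 1 = AddMonoidHom.id _ := by
  have hφ : outerConjSubgroup H hH 1 = ContinuousMonoidHom.id H := by
    ext x
    rw [outerConjSubgroup_apply_coe, inv_one, absGaloisOuterConj_one_apply]
    rfl
  have hψ : DistribSMul.toAddMonoidHom M (1 : absoluteGaloisGroup F) = AddMonoidHom.id M := by
    ext m; simp
  rw [outerConjH1, resH1Hom_congr hφ hψ _ (fun _ _ ↦ rfl), resH1Hom_id]

/-- `outerConjH1 (τ τ') = outerConjH1 τ ∘ outerConjH1 τ'` (the outer action is an action). [cite: SerreGaloisCohomology1997, I §2.4] -/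
theorem outerConjH1_mul (τ τ' : absoluteGaloisGroup F) :
    outerConjH1 H hH M hM (τ * τ') = (outerConjH1 H hH M hM τ).comp (outerConjH1 H hH M hM τ') := by
  rw [outerConjH1, outerConjH1, outerConjH1, resH1Hom_comp]
  refine resH1Hom_congr ?_ ?_ _ _
  · ext x
    rw [outerConjSubgroup_apply_coe, mul_inv_rev, absGaloisOuterConj_mul_apply]
    rfl
  · ext m
    simp [mul_smul]

/-- On `res(Γ_L)` the outer action is the usual conjugation: `outerConjH1 (res σ₀) = conjH1 σ₀`.
[cite: SerreGaloisCohomology1997, I §2.5] -/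
theorem outerConjH1_absGaloisRestrict [H.Normal] (σ₀ : absoluteGaloisGroup L) :
    outerConjH1 H hH M hM (absGaloisRestrict F L σ₀) = conjH1 H M σ₀ := by
  rw [outerConjH1, conjH1]
  refine resH1Hom_congr ?_ ?_ _ _
  · ext x
    rw [outerConjSubgroup_apply_coe, ← map_inv, absGaloisOuterConj_absGaloisRestrict_apply, inv_inv,
      subgroupConj_apply_coe]
  · ext m
    simp [hM]

/-- For an involution `τ` (e.g. a complex conjugation), `outerConjH1 τ` is an involution. [cite: SerreGaloisCohomology1997, I §2.4] -/
theorem outerConjH1_outerConjH1_of_mul_self (τ : absoluteGaloisGroup F) (hτ : τ * τ = 1) (c : subgroupH1 H M) :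
    outerConjH1 H hH M hM τ (outerConjH1 H hH M hM τ c) = c := by
  rw [← AddMonoidHom.comp_apply, ← outerConjH1_mul, hτ, outerConjH1_one, AddMonoidHom.id_apply]

end Laws

end Summit.BirchSwinnertonDyer.BirchSwinnertonDyer.Theorems.InterludeWithTorsion

end
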